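import Mathlib.Topology.MetricSpace.Isometry
import Literature.Analysis.FluidPDE.AxisymmetricVorticityTransport
import Summits.NavierStokesRegularity.NavierStokesRegularity.Theorems.L3TimeExponentPincerEquivariantLimit
import Summits.NavierStokesRegularity.NavierStokesRegularity.Theorems.L3TimeExponentPincerRecedingAxis
import Summits.NavierStokesRegularity.NavierStokesRegularity.Theorems.L3TimeExponentPincerConvergingAxes
import Summits.NavierStokesRegularity.NavierStokesRegularity.Theorems.L3TimeExponentPincerTimeCutConvergence
import HarnessLib.Audit
import HarnessLib

/-!
# L3TimeExponentPincer — space–time axisymmetry about converging axes passes to `L³_loc` limits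

Support kernel for the crux `L3CascadeJaw` (item stmt-NavierStokesRegularity-19499) of route
`L3TimeExponentPincer`: CASE B symmetry input of the compactness step (J) of planner nsreg-p2's
ROUND-12 §2b in the SPACE–TIME form the typed node (SFL³) will consume.  The slice lemma
`…ConvergingAxes.ae_isAxisymmetricAbout_of_tendsto` is lifted to space–time fields
`U : ℝ × ℝ³ → ℝ³` by instantiating `…EquivariantLimit.ae_comp_eq_of_tendsto_integral_smul` on
`E = ℝ × ℝ³` (sup-norm product, product Lebesgue measure) with the isometries
`(t, x) ↦ (t, a_k + R_θ (x - a_k))`: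

* `isometry_prodMap_rotZ_about`, `measurePreserving_prodMap_rotZ_about`,
  `contDiff_prodMap_rotZ_about`, `norm_prodMap_rotZ_about_sub_le` — the space–time rotations are
  measure-preserving smooth isometries converging uniformly when `a_k → a`;
* `ae_spaceTime_axisymmetricAbout_of_tendsto` — distributional limits (on all of `ℝ × ℝ³`) of
  locally-`L¹`-bounded space–time fields axisymmetric about the vertical axes through `a_k → a`
  are a.e. axisymmetric about the limit axis;
* **`ae_axisymmetricAbout_of_L3loc`** — the form used by (J): if `∫∫_K ‖u^k - u‖³ → 0` for every
  compact `K ⊆ {t > 0}` (the `tendsto_lintegral` clause of `RusinSverak2011.CompactnessSituation`),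
  the `u^k`, `u` are locally integrable on `{t > 0}`, and every slice `u^k(t, ·)`, `t > 0`, is
  axisymmetric about the vertical axis through `a_k`, `a_k → a`, then for every angle `θ`,
  `u(t, a + R_θ (x - a)) = R_θ u(t, x)` for a.e. `(t, x)` with `t > 0` (time cuts at `δ = 1/(n+1)`,
  `…TimeCutConvergence`, and a countable union).

WHAT THIS IS NOT: not NS regularity or blow-up; measure-theoretic bookkeeping; the crux
`L3CascadeJaw` is untouched; no crux claim.
-/

noncomputable section

open MeasureTheory Set Function Filter Topology Metric
open scoped ENNReal NNReal ContDiff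

namespace Summit.NavierStokesRegularity.NavierStokesRegularity.Theorems.L3TimeExponentPincerSpaceTimeAxisymmetry

open Literature.Analysis.FluidPDE
open Summit.NavierStokesRegularity.NavierStokesRegularity.Theorems.L3TimeExponentPincerEquivariantLimit
open Summit.NavierStokesRegularity.NavierStokesRegularity.Theorems.L3TimeExponentPincerRecedingAxis
open Summit.NavierStokesRegularity.NavierStokesRegularity.Theorems.L3TimeExponentPincerConvergingAxes
open Summit.NavierStokesRegularity.NavierStokesRegularity.Theorems.L3TimeExponentPincerTimeCutConvergence

/-! ### Space–time rotations about vertical axes -/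

/-- `(t, x) ↦ (t, a + R_θ(x - a))` is an isometry of `ℝ × ℝ³` (sup-norm product metric). -/
theorem isometry_prodMap_rotZ_about (a : EuclideanSpace ℝ (Fin 3)) (θ : ℝ) :
    Isometry (Prod.map (id : ℝ → ℝ) (fun x : EuclideanSpace ℝ (Fin 3) => a + rotZ θ (x - a))) :=
  isometry_id.prodMap (isometry_rotZ_about a θ)

/-- `(t, x) ↦ (t, a + R_θ(x - a))` preserves the product Lebesgue measure. -/
theorem measurePreserving_prodMap_rotZ_about (a : EuclideanSpace ℝ (Fin 3)) (θ : ℝ) :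
    MeasurePreserving (Prod.map (id : ℝ → ℝ) (fun x : EuclideanSpace ℝ (Fin 3) => a + rotZ θ (x - a)))
      volume volume :=
  (MeasurePreserving.id volume).prod (measurePreserving_rotZ_about a θ)

/-- `(t, x) ↦ (t, a + R_θ(x - a))` is smooth. -/
theorem contDiff_prodMap_rotZ_about (a : EuclideanSpace ℝ (Fin 3)) (θ : ℝ) :
    ContDiff ℝ ∞ (Prod.map (id : ℝ → ℝ) (fun x : EuclideanSpace ℝ (Fin 3) => a + rotZ θ (x - a))) :=
  contDiff_id.prodMap (contDiff_rotZ_about a θ)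

/-- The space–time rotations about converging axes converge uniformly:
`‖(t, b + R_θ(x - b)) - (t, b' + R_θ(x - b'))‖ ≤ 2‖b - b'‖`. -/
theorem norm_prodMap_rotZ_about_sub_le (θ : ℝ) (b b' : EuclideanSpace ℝ (Fin 3))
    (z : ℝ × EuclideanSpace ℝ (Fin 3)) :
    ‖Prod.map (id : ℝ → ℝ) (fun x : EuclideanSpace ℝ (Fin 3) => b + rotZ θ (x - b)) z -
        Prod.map (id : ℝ → ℝ) (fun x : EuclideanSpace ℝ (Fin 3) => b' + rotZ θ (x - b')) z‖
      ≤ 2 * ‖b - b'‖ := by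
  rw [Prod.norm_def]
  simp only [Prod.map_fst, Prod.map_snd, Prod.fst_sub, Prod.snd_sub, id, sub_self, norm_zero]
  rw [max_eq_right (norm_nonneg _)]
  exact norm_rotation_about_sub_le θ b b' z.2

/-- Uniform convergence on bounded sets (the form consumed by `ae_comp_eq_of_tendsto_integral_smul`). -/
theorem prodMap_rotZ_about_tendsto {b : ℕ → EuclideanSpace ℝ (Fin 3)} {bl : EuclideanSpace ℝ (Fin 3)}
    (hb : Tendsto b atTop (𝓝 bl)) (θ : ℝ) :
    ∀ R ε : ℝ, 0 < ε → ∀ᶠ k in atTop, ∀ z ∈ closedBall (0 : ℝ × EuclideanSpace ℝ (Fin 3)) R,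
      ‖Prod.map (id : ℝ → ℝ) (fun x : EuclideanSpace ℝ (Fin 3) => b k + rotZ θ (x - b k)) z -
        Prod.map (id : ℝ → ℝ) (fun x : EuclideanSpace ℝ (Fin 3) => bl + rotZ θ (x - bl)) z‖ ≤ ε := by
  intro R ε hε
  have h : ∀ᶠ k in atTop, dist (b k) bl ≤ ε / 2 :=
    (Metric.tendsto_nhds.1 hb (ε / 2) (by positivity)).mono fun k hk => hk.le
  filter_upwards [h] with k hk z _
  calc _ ≤ 2 * ‖b k - bl‖ := norm_prodMap_rotZ_about_sub_le θ _ _ z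
    _ ≤ 2 * (ε / 2) := by rw [← dist_eq_norm]; gcongr
    _ = ε := by ring

/-! ### Space–time axisymmetry passes to distributional limits -/

/-- **Distributional limits of space–time fields axisymmetric about converging axes are
axisymmetric about the limit axis.**  `U_k : ℝ × ℝ³ → ℝ³` locally integrable with locally uniform
`L¹` bounds, `U_k (t, a_k + R_θ(x - a_k)) = R_θ U_k (t, x)` for all `(t,x)`, `a_k → a`, and
`∫ g • U_k → ∫ g • U` for every `g ∈ C_c^∞(ℝ × ℝ³; ℝ)`, `U` locally integrable ⇒
`U (t, a + R_θ(x - a)) = R_θ U (t, x)` for a.e. `(t, x)`. -/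
theorem ae_spaceTime_axisymmetricAbout_of_tendsto
    {U : ℕ → ℝ × EuclideanSpace ℝ (Fin 3) → EuclideanSpace ℝ (Fin 3)}
    {Ul : ℝ × EuclideanSpace ℝ (Fin 3) → EuclideanSpace ℝ (Fin 3)}
    {a : ℕ → EuclideanSpace ℝ (Fin 3)} {al : EuclideanSpace ℝ (Fin 3)} {θ : ℝ}
    (hax : ∀ k z, U k (z.1, a k + rotZ θ (z.2 - a k)) = rotZ θ (U k z))
    (ha : Tendsto a atTop (𝓝 al))
    (hU : ∀ k, LocallyIntegrable (U k) volume)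
    (hbd : ∀ R : ℝ, ∃ C : ℝ, ∀ k,
      ∫ z in closedBall (0 : ℝ × EuclideanSpace ℝ (Fin 3)) R, ‖U k z‖ ≤ C)
    (hUl : LocallyIntegrable Ul volume)
    (hconv : ∀ g : ℝ × EuclideanSpace ℝ (Fin 3) → ℝ, ContDiff ℝ ∞ g → HasCompactSupport g →
      Tendsto (fun k => ∫ z, g z • U k z) atTop (𝓝 (∫ z, g z • Ul z))) :
    (fun z : ℝ × EuclideanSpace ℝ (Fin 3) => Ul (z.1, al + rotZ θ (z.2 - al))) =ᵐ[volume]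
      fun z => rotZ θ (Ul z) := by
  have h := ae_comp_eq_of_tendsto_integral_smul (μ := volume) (f := U) (fl := Ul)
    (T := fun k => Prod.map (id : ℝ → ℝ) (fun x : EuclideanSpace ℝ (Fin 3) => a k + rotZ θ (x - a k)))
    (Tl := Prod.map (id : ℝ → ℝ) (fun x : EuclideanSpace ℝ (Fin 3) => al + rotZ θ (x - al)))
    (Sl := Prod.map (id : ℝ → ℝ) (fun x : EuclideanSpace ℝ (Fin 3) => al + rotZ (-θ) (x - al)))
    (M := fun _ => rotZL θ) (Ml := rotZL θ)
    (fun k => measurePreserving_prodMap_rotZ_about _ _) (fun k => isometry_prodMap_rotZ_about _ _)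
    (measurePreserving_prodMap_rotZ_about _ _) (isometry_prodMap_rotZ_about _ _)
    (contDiff_prodMap_rotZ_about _ _) (isometry_prodMap_rotZ_about _ _)
    (contDiff_prodMap_rotZ_about _ _)
    (fun z => Prod.ext rfl (rotZ_about_neg_rotZ_about al θ z.2))
    (fun z => Prod.ext rfl (rotZ_about_rotZ_about_neg al θ z.2))
    (prodMap_rotZ_about_tendsto ha θ) tendsto_const_nhds
    (fun k => Eventually.of_forall fun z => by
      show U k (Prod.map (id : ℝ → ℝ) (fun x : EuclideanSpace ℝ (Fin 3) => a k + rotZ θ (x - a k)) z)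
        = rotZL θ (U k z)
      rw [show Prod.map (id : ℝ → ℝ) (fun x : EuclideanSpace ℝ (Fin 3) => a k + rotZ θ (x - a k)) z
          = (z.1, a k + rotZ θ (z.2 - a k)) from Prod.ext rfl rfl, rotZL_apply]
      exact hax k z) hU hbd hUl hconv
  filter_upwards [h] with z hz
  rw [show ((z.1, al + rotZ θ (z.2 - al)) : ℝ × EuclideanSpace ℝ (Fin 3))
      = Prod.map (id : ℝ → ℝ) (fun x : EuclideanSpace ℝ (Fin 3) => al + rotZ θ (x - al)) z
      from Prod.ext rfl rfl]
  simpa only [rotZL_apply] using hz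

/-! ### The form used by (J): `L³_loc` limits on `{t > 0}` -/

/-- **A.e. axisymmetry of `L³_loc` limits of axisymmetric fields about converging axes.**
If `∫∫_K ‖u^k - u‖³ → 0` for every compact `K ⊆ {t > 0}`, all fields are locally integrable on
`{t > 0}`, each slice `u^k(t,·)` (`t > 0`) is axisymmetric about the vertical axis through `a_k`,
and `a_k → a`, then for every `θ`: `u (t, a + R_θ(x - a)) = R_θ u (t, x)` for a.e. `(t,x)` with
`t > 0`. -/
theorem ae_axisymmetricAbout_of_L3loc
    {useq : ℕ → ℝ → EuclideanSpace ℝ (Fin 3) → EuclideanSpace ℝ (Fin 3)}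
    {u : ℝ → EuclideanSpace ℝ (Fin 3) → EuclideanSpace ℝ (Fin 3)}
    {a : ℕ → EuclideanSpace ℝ (Fin 3)} {al : EuclideanSpace ℝ (Fin 3)}
    (hL3 : ∀ K ⊆ {z : ℝ × EuclideanSpace ℝ (Fin 3) | 0 < z.1}, IsCompact K →
      Tendsto (fun k => ∫⁻ z in K, ‖useq k z.1 z.2 - u z.1 z.2‖ₑ ^ (3 : ℕ)) atTop (𝓝 0))
    (huk : ∀ k, LocallyIntegrableOn (uncurry (useq k)) {z | 0 < z.1} volume)
    (hu : LocallyIntegrableOn (uncurry u) {z | 0 < z.1} volume)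
    (hax : ∀ k t, 0 < t → ∀ (θ : ℝ) x, useq k t (a k + rotZ θ (x - a k)) = rotZ θ (useq k t x))
    (ha : Tendsto a atTop (𝓝 al)) (θ : ℝ) :
    ∀ᵐ z : ℝ × EuclideanSpace ℝ (Fin 3) ∂volume, 0 < z.1 →
      u z.1 (al + rotZ θ (z.2 - al)) = rotZ θ (u z.1 z.2) := by
  -- for each cut height `δ = 1/(n+1)`
  have hcut : ∀ n : ℕ, ∀ᵐ z : ℝ × EuclideanSpace ℝ (Fin 3) ∂volume, (1 : ℝ) / (n + 1) < z.1 →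
      u z.1 (al + rotZ θ (z.2 - al)) = rotZ θ (u z.1 z.2) := by
    intro n
    set δ : ℝ := 1 / (n + 1) with hδdef
    have hδ : 0 < δ := by positivity
    set S : Set (ℝ × EuclideanSpace ℝ (Fin 3)) := Ioi δ ×ˢ univ with hS
    have hL3' : ∀ K ⊆ {z : ℝ × EuclideanSpace ℝ (Fin 3) | 0 < z.1}, IsCompact K →
        Tendsto (fun k => ∫⁻ z in K, ‖uncurry (useq k) z - uncurry u z‖ₑ ^ (3 : ℕ)) atTop (𝓝 0) :=
      hL3
    have h := ae_spaceTime_axisymmetricAbout_of_tendsto (θ := θ)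
      (U := fun k => S.indicator (uncurry (useq k))) (Ul := S.indicator (uncurry u)) (a := a) (al := al)
      (fun k z => by
        by_cases hz : z ∈ S
        · have hz' : ((z.1, a k + rotZ θ (z.2 - a k)) : ℝ × EuclideanSpace ℝ (Fin 3)) ∈ S :=
            ⟨hz.1, mem_univ _⟩
          rw [indicator_of_mem hz', indicator_of_mem hz]
          exact hax k z.1 (lt_trans hδ hz.1) θ z.2
        · have hz' : ((z.1, a k + rotZ θ (z.2 - a k)) : ℝ × EuclideanSpace ℝ (Fin 3)) ∉ S :=
            fun h => hz ⟨h.1, mem_univ _⟩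
          rw [indicator_of_notMem hz', indicator_of_notMem hz, ← rotZL_apply, map_zero])
      ha (fun k => locallyIntegrable_timeCut (huk k) hδ)
      (fun R => exists_setIntegral_norm_timeCut_le hL3' huk hu hδ R)
      (locallyIntegrable_timeCut hu hδ)
      (fun g hg hgs => tendsto_integral_smul_timeCut hL3' huk hu hδ hg.continuous hgs)
    filter_upwards [h] with z hz hzt
    have hzS : z ∈ S := ⟨hzt, mem_univ _⟩
    have hzS' : ((z.1, al + rotZ θ (z.2 - al)) : ℝ × EuclideanSpace ℝ (Fin 3)) ∈ S := ⟨hzt, mem_univ _⟩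
    have := hz
    simp only [indicator_of_mem hzS, indicator_of_mem hzS', uncurry] at this
    exact this
  rw [← ae_all_iff] at hcut
  filter_upwards [hcut] with z hz hzt
  obtain ⟨n, hn⟩ := exists_nat_one_div_lt hzt
  exact hz n hn

end Summit.NavierStokesRegularity.NavierStokesRegularity.Theorems.L3TimeExponentPincerSpaceTimeAxisymmetry

end
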